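import Summits.QuantumFields.YangMills.Theorems.UV3BranchExpansionSocketWeightsSU2AllLPow
import Summits.QuantumFields.YangMills.Theorems.UV3BranchExpansionHTopT3AllL
import HarnessLib

/-!
# R3 (cell `ym3-torus`, YM₃ on T³ — a ladder RUNG, NOT d = 4, NOT infinite volume, NOT a mass gap, NOT the Clay problem) —
# **(F-TOP-T3-EVERY-L) hTop — THE K-UNIFORM TOP PUSH-FORWARD BOUND OF THE GUARDED BLOCK AVERAGING — FOR EVERY THREE-TORUS FAMILY, NO HYPOTHESIS**

Width seat `ym-ust-19936-w8` g13 on crux `stmt-QuantumFields-19936` `UnitScaleTilt.HistoryTailL` (`--supports`, helper; THEOREMS ONLY, 0 `def`, 0 `sorry`, default heartbeats);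
★★OWNER WORD 101 (2026-08-30 07:53Z) «GO hTop-∀F: (A) by n08-d g50, (B) via w8 g13; then the hTop shelf is FULL».  CREDIT: §1–§2 are RE-DERIVED VERBATIM (docstrings
and proofs) from dag-n08-d g50's kernel-clean scratch `pub-ymgap-dag-n08-d/lean/g50/UV3BranchExpansionHTopT3EveryL.SIGNATURE.g50.lean` (sha16 545991ae1e7da632; end-to-end
cert `DockHTopT3EveryL.rc0.g50.lean` 2871359d6fa2f2c7) — the mathematics and the typing are g50's; this seat files them in the crux lane's vocabulary per WORD 101 (B), with the
consumers split off into ✓`UV3HTopConsumersT3` (sequel).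

THE POINT.  px13 g14's ✓`UV3BranchExpansionHTopT3AllL.topHaarPushforward_of_T3_le_twenty` is hTop(F) for every `F.L ≤ 20` — the range of the record (H_K) constant.  With
dag-n08-d's ∀-L constant (✓p765628 `…GuardCoreLawSU2AllL`, over this seat's bricks ✓B1–B4∕B3a∕B3b), its socket binder (✓p765740 `hw_su2_allL`, polynomial edition ✓`hw_su2_allL_pow`
of ✓`…SocketWeightsSU2AllLPow`) and the numeric tail (✓`two_mul_kpow_mul_ratio_le`, `L ≥ 6`) the same knit runs for every `L ≥ 6`, and `L ≤ 20 ∨ 6 ≤ L` is all of `ℕ`: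
 §1 ★★★ `map_iterFrom_blockAvg_le_exp_smul_ge (F) (h6 : 6 ≤ F.L) (K j n) (hjn)` — one segment, hypothesis-free but the range (px8 g13's ✓`map_iterFrom_le_exp_smul_of_hw` ∘
    ✓`exists_traj` at `hw_su2_allL_pow`, `δ′ = 1∕21`, `(y, θ₀) = (9∕10, (1 + (9∕10)^{L−1})∕2)`, rows by px13's K-agnostic ✓`smallness_T3_anyL_of_ennreal_le` at the
    threshold `a_L = (9∕10)^{5(L−1)}∕(10⁴L⁴)` met by ✓`two_mul_kpow_mul_ratio_le`);
 §2 ★★★ `topBlockAvgPushforward_of_ge` · ★★★★ `topHaarPushforward_of_ge (F) (h6)` · ★★★★★ **`topHaarPushforward_of_T3 (F : T3Family)` : `∃ c ≥ 0, ∀ K j n, j + n = K →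
    (dU_j^{(K)}).map (iterFrom (avT3 F K) j n) ≤ ofReal (exp c) • dU_{j+n}^{(K)}` — hTop FOR EVERY THREE-TORUS FAMILY, NO HYPOTHESIS** (`_le_twenty` ∨ `_of_ge`) — the SAME
    conclusion text as ✓p763650's (the `hTop` binder of ✓`…PinnedStepOrganOfTopPartialIteratesKnit.hSii_of_topHaarPushforward` ∕ ✓`startClosed_avT3_of_topHaarPushforward`,
    ★★OWNER RECORD 17br letter-fit), range GONE.

HYP-SAT (★★OWNER RULING №42): `topHaarPushforward_of_T3` has NO hypothesis at all (every `F : T3Family`); §1∕`_of_ge` carry the literal range `6 ≤ F.L` (T³: every odd `L ≥ 7`;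
`3, 5` and everything `≤ 20` are ✓p763650's rows).  RECORD CURRENCY (WORDS 84 (2) ∕ 85 (4) ∕ 98 ∕ 17bs′ ∕ 101): hTop is SUPPLY for NODE O B3 ∕ Track A's N08, NOT a row of the
19936 registry v6 {EX, (O‴χₛ)}; «after (A)+(B) the hTop∕(H_K)∕N08 supply shelf of this cell is FULL» (WORD 101).

HONEST SCOPE.  Composition bookkeeping over landed engines and kernel numerals ([folklore]); nothing of the χ record ∕ (O‴χₛ) ∕ EX ∕ `HistoryTailL` (19936) ∕ `YM3TorusSU2` ∕
the rung ∕ d = 4 ∕ a mass gap ∕ Clay is proved.  YM₃ on T³ is rung R3 of the ladder; the Yang–Mills mass gap is NOT proved.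

References: T. Bałaban, CMP **102** (1985) 255–275 [Balaban1985UV3] ((2) p. 256, (5) p. 257, (41) p. 266); [Balaban1987RG1] ((0.4), (0.11) p. 253).
-/

set_option autoImplicit false

noncomputable section

namespace Summit.QuantumFields.YangMills.Theorems.UV3BranchExpansionHTopT3EveryL

open MeasureTheory
open scoped ENNReal
open Literature.MathematicalPhysics.QuantumFieldTheory (haarProbability)
open Literature.MathematicalPhysics.QuantumFieldTheory.Balaban1983to89
open Literature.MathematicalPhysics.QuantumFieldTheory.Balaban1983to89.T3ContinuumYM3Torus
open Literature.MathematicalPhysics.QuantumFieldTheory.Balaban1983to89.T3UnitLawDensityEML (ℰp)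
open Literature.MathematicalPhysics.QuantumFieldTheory.Balaban1983to89.BlockAveraging (blockAvg)
open Literature.MathematicalPhysics.QuantumFieldTheory.Balaban1983to89.T4AvgSensitivity (iterFrom)
open Literature.MathematicalPhysics.QuantumFieldTheory.Balaban1983to89.ExpMeanLog (expMeanLogSU measurable_expMeanLogSU_E)
open Summit.QuantumFields.YangMills.Theorems.UV3BranchExpansionSocketWeightsSU (weight_base_ne_top)
open Summit.QuantumFields.YangMills.Theorems.UV3BranchExpansionSocketWeightsSU2AllLPow (one_le_kpow_and_ne_top hw_su2_allL_pow two_mul_kpow_mul_ratio_le)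
open Summit.QuantumFields.YangMills.Theorems.UV3BranchExpansionHTopSegment (exists_traj map_iterFrom_le_exp_smul_of_hw)
open Summit.QuantumFields.YangMills.Theorems.UV3BranchExpansionHaarBallSharp (haarData_dist1_lt_one_div_ne_zero)
open Summit.QuantumFields.YangMills.Theorems.UV3BranchExpansionCountingSmallness (M_pos)
open Summit.QuantumFields.YangMills.Theorems.UV3BranchExpansionCountingSmallnessT3 (smallness_T3_anyL_of_ennreal_le theta_allL_lt_one)
open Summit.QuantumFields.YangMills.Theorems.UV3BranchExpansionHTopT3L3 (card_pBond_top)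
open Summit.QuantumFields.YangMills.Theorems.UV3BranchExpansionHTopT3AllL (topHaarPushforward_of_T3_le_twenty)
open Summit.QuantumFields.YangMills.Theorems.UV3PinnedStepOrganOfTopPartialIterates (iterFrom_avT3_eq_iterFrom_blockAvg)

/-! ## §1 One segment of a three-torus family with `L ≥ 6`: no hypothesis but the range -/

/-- ★★★ **hTop FOR ONE SEGMENT OF A THREE-TORUS FAMILY WITH `21 ≤ L`, HYPOTHESIS-FREE** (px13's ✓`map_iterFrom_blockAvg_le_exp_smul_allL` with the ∀-L socket
`hw_su2_allL_pow`, the tail `two_mul_kpow_mul_ratio_le` and the K-agnostic rows ✓`smallness_T3_anyL_of_ennreal_le`; threshold `a_L = (9∕10)^{5(L−1)}∕(10⁴L⁴)` in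
place of `10⁻¹⁴`). [cite: Balaban1987RG1, (0.4) p.253; Balaban1985UV3, (2) p.256] -/
theorem map_iterFrom_blockAvg_le_exp_smul_ge (F : T3Family) (h6 : 6 ≤ F.L) (K j n : ℕ) (hjn : j + n ≤ F.m + K) :
    (fieldMeasure (F.P K) j (Matrix.specialUnitaryGroup (Fin 2) ℂ)).map
        (iterFrom (fun i => blockAvg (P := F.P K) (G := Matrix.specialUnitaryGroup (Fin 2) ℂ) (j := i) ℰp) j n) ≤
      ENNReal.ofReal (Real.exp (Fintype.card (PBond (F.P K) (j + n)) *
        (2 / (1 - (1 + (9 / 10 : ℝ) ^ (F.L - 1)) / 2) *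
          ((9 / 10 : ℝ) ^ ((2 * 3 - 1) * (F.L - 1)) / (10 ^ 4 * (F.L : ℝ) ^ 4) / (9 / 10 : ℝ) ^ ((2 * 3 - 1) * (F.L - 1)))))) •
        fieldMeasure (F.P K) (j + n) (Matrix.specialUnitaryGroup (Fin 2) ℂ) := by
  have hd : (F.P K).d = 3 := rfl
  have hPL : (F.P K).L = F.L := rfl
  have h4 : 4 ≤ F.L := by omega
  have hjn' : j + n ≤ (F.P K).m + (F.P K).K := hjn
  have hθ₀ : (1 + (9 / 10 : ℝ) ^ (F.L - 1)) / 2 < 1 := theta_allL_lt_one h4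
  set W : ℝ≥0∞ := ENNReal.ofReal (10 ^ 17 * (((F.P K).L : ℝ) ^ ((F.P K).d - 1)) ^ 7) *
      ((HaarData.haar : Measure (Matrix.specialUnitaryGroup (Fin 2) ℂ)) {g | dist1 g < 1 / 3 + 1 / 21} ^ ((F.P K).L ^ ((F.P K).d - 1) - 1) /
        (HaarData.haar : Measure (Matrix.specialUnitaryGroup (Fin 2) ℂ)) {g | dist1 g < 1 / 21}) with hW
  have hW2 : 2 * W ≤ ENNReal.ofReal ((9 / 10 : ℝ) ^ ((2 * 3 - 1) * (F.L - 1)) / (10 ^ 4 * (F.L : ℝ) ^ 4)) := by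
    rw [hW, hd, hPL]
    exact two_mul_kpow_mul_ratio_le h6
  have hWtop : W ≠ ⊤ := by
    intro h
    rw [h, ENNReal.mul_top (by norm_num)] at hW2
    exact absurd hW2 (by simp)
  have h2W : (2 * W).toReal = 2 * W.toReal := by
    rw [ENNReal.toReal_mul]; norm_num
  have hxle : 2 * W.toReal ≤ (9 / 10 : ℝ) ^ ((2 * 3 - 1) * (F.L - 1)) / (10 ^ 4 * (F.L : ℝ) ^ 4) := by
    rw [← h2W]; exact ENNReal.toReal_le_of_le_ofReal (by positivity) hW2
  obtain ⟨hE, hG⟩ := smallness_T3_anyL_of_ennreal_le h4 hW2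
  rw [h2W] at hE hG
  obtain ⟨V, hV0, hVs⟩ := exists_traj (P := F.P K) (expMeanLogSU : LoopAverage (Matrix.specialUnitaryGroup (Fin 2) ℂ)) j n
  have hseg := map_iterFrom_le_exp_smul_of_hw (expMeanLogSU : LoopAverage (Matrix.specialUnitaryGroup (Fin 2) ℂ)) j n measurable_expMeanLogSU_E V hV0 hVs hjn'
    (weight_base_ne_top (one_le_kpow_and_ne_top (P := F.P K)).2 (1 / 3 + 1 / 21) (1 / 21) ((F.P K).L ^ ((F.P K).d - 1) - 1)
      haarData_dist1_lt_one_div_ne_zero)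
    (hw_su2_allL_pow n V hV0 hVs hjn' (1 / 21) haarData_dist1_lt_one_div_ne_zero)
    (y := 9 / 10) (θ₀ := (1 + (9 / 10 : ℝ) ^ (F.L - 1)) / 2) (by norm_num) (by norm_num) hθ₀
    (by rw [← hW, hd, hPL]; exact hE) (by rw [← hW, hd, hPL]; exact hG)
  rw [← hW, hd, hPL] at hseg
  refine hseg.trans (Measure.le_iff.2 fun B _ => ?_)
  rw [Measure.smul_apply, Measure.smul_apply, smul_eq_mul, smul_eq_mul]
  refine mul_le_mul' (ENNReal.ofReal_le_ofReal (Real.exp_le_exp.mpr ?_)) le_rfl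
  refine mul_le_mul_of_nonneg_left ?_ (Nat.cast_nonneg _)
  exact mul_le_mul_of_nonneg_left (div_le_div_of_nonneg_right hxle (by positivity)) (M_pos hθ₀).le

/-! ## §2 hTop for EVERY three-torus family -/

/-- ★★★ **THE TOP BLOCK-AVERAGING PUSH-FORWARD ROW FOR `L ≥ 6`**: one `c ≥ 0` (K-free by ✓`card_pBond_top`). [cite: Balaban1985UV3, (2) p.256, (5) p.257] -/
theorem topBlockAvgPushforward_of_ge (F : T3Family) (h6 : 6 ≤ F.L) :
    ∃ c : ℝ, 0 ≤ c ∧ ∀ (K j n : ℕ), j + n = K →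
      (fieldMeasure (F.P K) j (Matrix.specialUnitaryGroup (Fin 2) ℂ)).map
          (iterFrom (fun i => blockAvg (P := F.P K) (G := Matrix.specialUnitaryGroup (Fin 2) ℂ) (j := i) ℰp) j n) ≤
        ENNReal.ofReal (Real.exp c) • fieldMeasure (F.P K) (j + n) (Matrix.specialUnitaryGroup (Fin 2) ℂ) := by
  have h4 : 4 ≤ F.L := by omega
  have hθ₀ : (1 + (9 / 10 : ℝ) ^ (F.L - 1)) / 2 < 1 := theta_allL_lt_one h4
  have hM0 : 0 < 2 / (1 - (1 + (9 / 10 : ℝ) ^ (F.L - 1)) / 2) := M_pos hθ₀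
  refine ⟨((2 * F.L ^ F.m) ^ 3 * 3 : ℕ) *
      (2 / (1 - (1 + (9 / 10 : ℝ) ^ (F.L - 1)) / 2) *
        ((9 / 10 : ℝ) ^ ((2 * 3 - 1) * (F.L - 1)) / (10 ^ 4 * (F.L : ℝ) ^ 4) / (9 / 10 : ℝ) ^ ((2 * 3 - 1) * (F.L - 1)))),
    by positivity, fun K j n hK => ?_⟩
  have h := map_iterFrom_blockAvg_le_exp_smul_ge F h6 K j n (by omega)
  have hcard : Fintype.card (PBond (F.P K) (j + n)) = (2 * F.L ^ F.m) ^ 3 * 3 := by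
    rw [hK, card_pBond_top]
  rw [hcard] at h
  exact h

/-- ★★★★ **hTop FOR EVERY THREE-TORUS FAMILY WITH `L ≥ 6`** in the crux lane's letter (`avT3` IS `blockAvg ℰp` in range). [cite: Balaban1985UV3, (2) p.256, (5) p.257] -/
theorem topHaarPushforward_of_ge (F : T3Family) (h6 : 6 ≤ F.L) :
    ∃ c : ℝ, 0 ≤ c ∧ ∀ (K j n : ℕ), j + n = K →
      (fieldMeasure (F.P K) j (Matrix.specialUnitaryGroup (Fin 2) ℂ)).map (iterFrom (avT3 F K) j n) ≤
        ENNReal.ofReal (Real.exp c) • fieldMeasure (F.P K) (j + n) (Matrix.specialUnitaryGroup (Fin 2) ℂ) := by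
  obtain ⟨c, hc0, hc⟩ := topBlockAvgPushforward_of_ge F h6
  refine ⟨c, hc0, fun K j n hjn => ?_⟩
  rw [iterFrom_avT3_eq_iterFrom_blockAvg F K j n (by omega)]
  exact hc K j n hjn

/-- ★★★★★ **hTop FOR EVERY THREE-TORUS FAMILY, NO HYPOTHESIS**: `∀ F : T3Family, ∃ c ≥ 0, ∀ K j n, j + n = K →
(dU_j^{(K)}).map (iterFrom (avT3 F K) j n) ≤ ofReal (exp c) • dU_{j+n}^{(K)}` — px13's ✓`topHaarPushforward_of_T3_le_twenty` (`L ≤ 20`, record constant) ∨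
`topHaarPushforward_of_ge` (`L ≥ 6`, the ∀-L constant of `…GuardCoreLawSU2AllL`).  SUPPLY for `HistoryTailL`'s hTop letter at every `L`; nothing of (O‴χₛ) ∕ EX ∕
`HistoryTailL` itself is proved; R3 ≠ d = 4 ∕ mass gap ∕ Clay. [cite: Balaban1985UV3, (2) p.256, (5) p.257, (41) p.266; Balaban1987RG1, (0.4) p.253] -/
theorem topHaarPushforward_of_T3 (F : T3Family) :
    ∃ c : ℝ, 0 ≤ c ∧ ∀ (K j n : ℕ), j + n = K →
      (fieldMeasure (F.P K) j (Matrix.specialUnitaryGroup (Fin 2) ℂ)).map (iterFrom (avT3 F K) j n) ≤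
        ENNReal.ofReal (Real.exp c) • fieldMeasure (F.P K) (j + n) (Matrix.specialUnitaryGroup (Fin 2) ℂ) := by
  by_cases h : F.L ≤ 20
  · exact topHaarPushforward_of_T3_le_twenty F h
  · exact topHaarPushforward_of_ge F (by omega)

end Summit.QuantumFields.YangMills.Theorems.UV3BranchExpansionHTopT3EveryL

end
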